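import Literature.IUT.HodgeTheaters.InitialThetaDataBadLocalFrobenioidTempered
import Literature.AlgebraicGeometry.Frobenioids.BirationalizationCategoryTheoreticity
import HarnessLib

/-!
# [IUTchI] Example 3.2 (ii) `BiratFromF` AT THE GENUINE BAD DATUM when `F÷_v` IS the [FrdI] §4 birationalization of
# the [EtTh] tempered Frobenioid: reduction to [FrdI] Cor. 4.10 (category-theoreticity of the birationalization)

S. Mochizuki, *Inter-universal Teichmüller theory I*, kurims manuscript (May 2020), Example 3.2 (ii) p. 70: "the
birationalization `F÷_v := F̲_v^birat` [which] may be reconstructed category-theoretically from `F̲_v` [cf. [FrdI],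
Corollary 4.10; [EtTh], Proposition 5.1]" [claim: Mochizuki2012, status: disputed] (D-0012 claim key, series status
DISPUTED; this file is a PROOF-ONLY composition; nothing of the series is asserted; no side is taken on [IUTchIII] Cor.
3.12).  DAG nodes `IUTchI:Ex3.2(i)`/`(ii)` (decl `BadLocalFrobenioid.BiratFromF` attached, `Summits/ABC/IUTFork/DAGL5p.lean`;
kernel census: FACT row F-0747 SCHEMA-REFUTED ⇒ instance-form), row E32ii/L01–L02 of `plan/L5/SUBDAG-IUTchI-Ex32.md`
(status before this file: "(β) INPUT fields; L1 has the birationalization of model Frobenioids — adapter not attempted"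
/ "(γ) schema … at ofKits it concerns the INPUT — not dischargeable in the tree").
S. Mochizuki, *The geometry of Frobenioids I*, Kyushu J. Math. **62** (2008), Cor. 4.10 p. 90: for an equivalence `Ψ`
of Frobenioids "there exists a 1-unique functor `Ψ^birat : C₁^birat → C₂^birat` that fits into a 1-commutative diagram"
with the natural functors `C_i → C_i^birat`, proof p. 91 "… from the definition of `C_i^birat` … and the fact that `Ψ`
preserves co-angular pre-steps [cf. Theorem 3.4, (ii)]" — abc-iut-L1's `PreFrobenioid.Birat.mapOfEquiv`,
`mapOfEquivFac`, `mapOfEquiv_isEquivalence` at THE birationalization `PreFrobenioid.Birat F hF hsq` (a localisation),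
with the Thm. 3.4 (ii) input displayed as `hΨ` [cite: MochizukiFrdI2008, Cor. 4.10 p.90].

WHAT IS PROVED.  abc-iut-L5-t2's interface types (ii) as `BiratFromF B := ∀ e : F̲_v ≌ F̲_v, ∃ e' : F÷_v ≌ F÷_v,
F̲_v → F÷_v ⋙ e' ≅ e ⋙ F̲_v → F÷_v`; in the assembly `ofKits … R.toInput` over an [EtTh] Def. 3.6 tempered Frobenioid
`Fr` (gen 6, `BadLocalFrobenioidOfKitsTempered.lean`) the functor `F̲_v → F÷_v` is the INPUT field `birat`.  THIS FILE
proves `BiratFromF` for EVERY tempered-side input whose `F÷_v` IS L1's birationalization `Birat Fr.toElem hF hsq` and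
whose `birat` IS the natural functor `toBirat` (displayed side condition `hb`), modulo [FrdI] Thm. 3.4 (ii) in the
form `hΨ` («every self-equivalence of `F̲_v` preserves co-angular pre-steps»):
* `BadLocalFrobenioid.biratFromF_ofKits_of_birat_eq_toBirat` (assembly, arbitrary `d`, `T`);
* `InitialThetaData.biratFromF_badLocalFrobenioidAt_of_birat_eq_toBirat` (GENUINE datum `K_v̲ = K_w`, ∀ `T`) and
  `…badLocalFrobenioidAtDoubleUnderline_of_birat_eq_toBirat` (at the [EtTh] §1 group datum `Π_v̲ := Π^tp_{X̲̲}`).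
HONEST LABEL: the side condition `hb` has NO inhabitant in the tree today — the rest-input structure with REAL `F÷_v`
(the other (ii) fields `𝒪^×(T^÷_{Ÿ_v}) ∋ Θ̲_v`, constants, `C^Θ_v ⊆ F÷_v` re-based on `toBirat`) is DEF-BEARING work of
record (row «E32ii-BIRAT-REAL», abc-iut-L5-t2 lineage, awaiting the L5 lead's word); this file is the PROOF half of
that row and pins the exact L1 inputs.  No new definition, instance or notation.  typed ≠ inhabited ≠ discharged.
-/

noncomputable section

namespace Literature.IUT.HodgeTheaters

open CategoryTheory Literature.AnabelianGeometry.SemiGraphs Literature.AlgebraicGeometry.Frobenioids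
open Literature.AlgebraicGeometry.Frobenioids.PadicFrd Literature.AnabelianGeometry.EtaleTheta Topology

universe u₀ v₀

/-! ### §1 `BiratFromF` for the assembly when `F÷_v = F̲_v^birat` is L1's birationalization -/

namespace BadLocalFrobenioid

variable {p : ℕ} [Fact p.Prime] (l : ℕ) (d : GaloisValDatum.{0} p) {P : Type} [Group P] [TopologicalSpace P]
  (T : BadLocalGroupDatum d.Gal P) (q qroot : intNonzero d.k) (hpow : qroot ^ (2 * l) = q) (hq : ¬ IsUnit qroot)
  {D₀ : Type u₀} [Category.{v₀} D₀] {V : FrdIMonoidStub.{0}} {T' : RealifiedDivisorMonoids (D₀ := D₀) V}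
  {VD : FrdICatStub.{0, 0, 0} T.Dv} (Fr : TemperedFrobenioid T' T.Dv VD)
  (hF : PreFrobenioid.IsFrobenioid Fr.toElem) (hsq : PreFrobenioid.HasBiratSquares Fr.toElem)
  {Cv : Type} [Category.{0} Cv]
  (K : TemperedThetaInput d T hq Fr.category (PreFrobenioid.Birat Fr.toElem hF hsq) Cv)

/-- **[IUTchI] Ex. 3.2 (ii) `BiratFromF` for the assembly `ofKits` over an [EtTh] tempered Frobenioid `F̲_v := Fr.category`
whose `F÷_v` IS the [FrdI] §4 birationalization `Birat Fr.toElem hF hsq` with `F̲_v → F÷_v = toBirat` (`hb`)**,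
modulo [FrdI] Thm. 3.4 (ii) in the form `hΨ` (self-equivalences of `F̲_v` preserve co-angular pre-steps): every
self-equivalence `e` of `F̲_v` lifts to `e^birat := Birat.mapOfEquiv … e` (abc-iut-L1, [FrdI] Cor. 4.10), an equivalence,
with `toBirat ⋙ e^birat ≅ e ⋙ toBirat` (`mapOfEquivFac`). ([IUTchI] Ex 3.2 (ii) p.70) [claim: Mochizuki2012, status: disputed] -/
theorem biratFromF_ofKits_of_birat_eq_toBirat (hb : K.birat = PreFrobenioid.toBirat Fr.toElem hF hsq)
    (hΨ : ∀ (e : Fr.category ≌ Fr.category) ⦃A B : Fr.category⦄ (f : A ⟶ B),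
      PreFrobenioid.IsCoAngularPreStep Fr.toElem f → PreFrobenioid.IsCoAngularPreStep Fr.toElem (e.functor.map f)) :
    (ofKits l d T q qroot hpow hq K).BiratFromF := by
  intro e
  haveI := PreFrobenioid.Birat.mapOfEquiv_isEquivalence hF hsq hF hsq e (hΨ e) (hΨ e.symm)
  refine ⟨(PreFrobenioid.Birat.mapOfEquiv hF hsq hF hsq e (hΨ e)).asEquivalence, ⟨?_⟩⟩
  change K.birat ⋙ PreFrobenioid.Birat.mapOfEquiv hF hsq hF hsq e (hΨ e) ≅ e.functor ⋙ K.birat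
  rw [hb]
  exact PreFrobenioid.Birat.mapOfEquivFac hF hsq hF hsq e (hΨ e)

end BadLocalFrobenioid

/-! ### §2 At the genuine datum and at the [EtTh] §1 group datum -/

section Datum

open NumberField IsDedekindDomain

variable {F K Fbar : Type} [Field F] [NumberField F] [Field K] [NumberField K] [Algebra F K]
  [Field Fbar] [Algebra F Fbar] [Algebra K Fbar] [IsScalarTower F K Fbar] {E : WeierstrassCurve F}
  [E.IsElliptic] {l : ℕ} {Pb : BadPlacePredicates K} (D : InitialThetaData F K Fbar E l Pb)
  {v : FinitePlace F} (hv : v ∈ D.VFbad) (w : HeightOneSpectrum (𝓞 K)) [w.asIdeal.LiesOver v.maximalIdeal.asIdeal]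
  (p : ℕ) [Fact p.Prime] (hw : ((p : ℕ) : 𝓞 K) ∈ w.asIdeal)
  {D₀ : Type u₀} [Category.{v₀} D₀] {V : FrdIMonoidStub.{0}} {T' : RealifiedDivisorMonoids (D₀ := D₀) V}

namespace InitialThetaData

/-- **[IUTchI] Ex. 3.2 (ii) `BiratFromF` AT THE GENUINE DATUM** (`K_v̲ = K_w`, genuine `q_v̲`, `q̲_v̲`, `C⊢_v̲`), for every
input group datum `T`, every [EtTh] tempered Frobenioid `Fr` on `D_v̲` and every tempered-side input whose `F÷_v` IS L1's
birationalization of `Fr.category` with `birat = toBirat` (`hb`), modulo [FrdI] Thm. 3.4 (ii) (`hΨ`).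
([IUTchI] Ex 3.2 (ii) p.70) [claim: Mochizuki2012, status: disputed] -/
theorem biratFromF_badLocalFrobenioidAt_of_birat_eq_toBirat {P : Type} [Group P] [TopologicalSpace P]
    (T : BadLocalGroupDatum (GaloisValDatum.ofPlace K p w hw).Gal P) {VD : FrdICatStub.{0, 0, 0} T.Dv}
    (Fr : TemperedFrobenioid T' T.Dv VD) (hF : PreFrobenioid.IsFrobenioid Fr.toElem)
    (hsq : PreFrobenioid.HasBiratSquares Fr.toElem) {Cv : Type} [Category.{0} Cv]
    (Kt : TemperedThetaInput (GaloisValDatum.ofPlace K p w hw) T (D.qRootAt_not_isUnit hv w p hw) Fr.category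
      (PreFrobenioid.Birat Fr.toElem hF hsq) Cv)
    (hb : Kt.birat = PreFrobenioid.toBirat Fr.toElem hF hsq)
    (hΨ : ∀ (e : Fr.category ≌ Fr.category) ⦃A B : Fr.category⦄ (f : A ⟶ B),
      PreFrobenioid.IsCoAngularPreStep Fr.toElem f → PreFrobenioid.IsCoAngularPreStep Fr.toElem (e.functor.map f)) :
    (D.badLocalFrobenioidAt hv w p hw T Kt).BiratFromF :=
  BadLocalFrobenioid.biratFromF_ofKits_of_birat_eq_toBirat l _ T _ _ _ _ Fr hF hsq Kt hb hΨ

variable {S : ThetaSetting p} {ES : S.EtaleThetaData} (dGL : S.toTemperedCurve.GroupLevelData) (hS2 : S.Sec2Hyps)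
  (C : ES.DoubleUnderline l) (ι : ↥S.GK ≃ₜ* (GaloisValDatum.ofPlace K p w hw).Gal)

/-- **[IUTchI] Ex. 3.2 (ii) `BiratFromF` AT THE [EtTh] §1 GROUP DATUM** (`Π_v̲ := Π^tp_{X̲̲}` of the double-underline
curve, `K_v̲ = K_w`), for every [EtTh] tempered Frobenioid `Fr` on `D_v̲ = CosetCat Π^tp_{X̲̲}` and every tempered-side
input with REAL `F÷_v` (`hb`), modulo [FrdI] Thm. 3.4 (ii) (`hΨ`). ([IUTchI] Ex 3.2 (ii) p.70) [claim: Mochizuki2012, status: disputed] -/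
theorem biratFromF_badLocalFrobenioidAtDoubleUnderline_of_birat_eq_toBirat
    {VD : FrdICatStub.{0, 0, 0} (badGroupDatumOfDoubleUnderline w p hw dGL hS2 C ι).Dv}
    (Fr : TemperedFrobenioid T' (badGroupDatumOfDoubleUnderline w p hw dGL hS2 C ι).Dv VD)
    (hF : PreFrobenioid.IsFrobenioid Fr.toElem) (hsq : PreFrobenioid.HasBiratSquares Fr.toElem)
    {Cv : Type} [Category.{0} Cv]
    (Kt : TemperedThetaInput (GaloisValDatum.ofPlace K p w hw) (badGroupDatumOfDoubleUnderline w p hw dGL hS2 C ι)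
      (D.qRootAt_not_isUnit hv w p hw) Fr.category (PreFrobenioid.Birat Fr.toElem hF hsq) Cv)
    (hb : Kt.birat = PreFrobenioid.toBirat Fr.toElem hF hsq)
    (hΨ : ∀ (e : Fr.category ≌ Fr.category) ⦃A B : Fr.category⦄ (f : A ⟶ B),
      PreFrobenioid.IsCoAngularPreStep Fr.toElem f → PreFrobenioid.IsCoAngularPreStep Fr.toElem (e.functor.map f)) :
    (D.badLocalFrobenioidAtDoubleUnderline hv w p hw dGL hS2 C ι Kt).BiratFromF :=
  D.biratFromF_badLocalFrobenioidAt_of_birat_eq_toBirat hv w p hw _ Fr hF hsq Kt hb hΨ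

end InitialThetaData

end Datum

end Literature.IUT.HodgeTheaters

end
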